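import Literature.MathematicalPhysics.QuantumFieldTheory.BalabanImbrieJaffe1984to88.BIJ88Eq5145HeadStruct
import Literature.MathematicalPhysics.QuantumFieldTheory.BalabanImbrieJaffe1984to88.BIJ88Ineq5144TwoCubeLeaf

/-!
# `BalabanImbrieJaffe1984to88.BIJ88Eq5145HeadThreeCube` — T. Bałaban, J. Imbrie, A. Jaffe, *Effective action and cluster properties of the abelian
Higgs model*, Commun. Math. Phys. **114** (1988) 257–315 [BalabanImbrieJaffe1988], Sect. 5.14, (5.14.5) p. 312 [PDF 56] with (5.14.4) p. 309:
**THE C2.Eq5.14.5 HEAD WITH ITS MULTI-CUBE LEAF HYPOTHESIS NARROWED TO THE POLYMERS WITH AT LEAST THREE CUBES, AND A KERNEL CERTIFICATE ON TWO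
ABUTTING CUBES WITH A COUPLED PRECISION** — RE-POINT CANDIDATE (successor head) for the owner's call (r16, by the v2.195 precedent «leaf
narrowing sound»; head of record p337083 `BIJ88Eq5145HeadMultiCube.eq5145_zG_mod_W6v_of_ineq5144_two_le`, structural form p340042
`BIJ88Eq5145HeadStruct`); §2 is the kernel non-vacuity certificate of §1 itself (every hypothesis discharged).

statement-level skeleton of published theorems with citation tags; proofs where landed; nothing here is a claim about the Yang–Mills mass gap

PDF held: `paper:balaban1988-cmp114-bij-abelian-higgs-effective-action` (journal page = PDF page + 256); pp. 309, 312 = PDF 53, 56.  p. 312, verbatim: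
*"Altogether, we have shown that … = exp[−𝒫^L_{k+1,loc}(Λ₁₂^{(k)}) − Σ_{X⊂Λ₁₂^{(k)}} W₆^{(k)}(X)]. (5.14.5)"*; p. 309, verbatim: *"Let us drop the
prime, and prove that |g₃(H_β, X_β)| ≦ (e^β(L^kε/ε₀)^{1/4−α})^{[|H_β| + β′|X_β∖H_β|]}. (5.14.4) … The proof of this estimate is similar to the one
for g₂."*; **p. 310 [PDF 54] (Sect. 5.14), verbatim — THE LICENSE UNDER WHICH THE ADJUSTED CONSTANTS OF §1 (`hvac₂`, `hekθ₂`, `hKθ₂`) ARE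
ADMITTED IN A HEAD** (owner r16's re-point ROWS-C2-part2 v2.224/v2.228, referee ref-5 gen 61 countersign, condition (a)): *"It is now a standard
exercise to estimate the expansion, using (5.14.4). The result is |W₆^{(k)′}(X)| ≦ (e^β(L^kε/ε₀)^{1/4−α})^{n̄+1+β′|X|}. (We allow adjustments in
β, α, β′, keeping them small.)"* [BalabanImbrieJaffe1988, p.310].

WHAT IS PROVED (unit `lit-balaban-p36`, generation 17 of the Phase-2 proof seat p36; SKELETON row **C2.Eq5.14.5** member cell of
`HOME/lit-balaban-r16/ROWS-C2-part2.md`, owner r16; row C2.Eq5.14.3-5.14.4 member).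
* §1 **`eq5145_zG_mod_W6v_of_ineq5144_three_le_struct`** — gen 16's structural head `BIJ88Eq5145HeadStruct.eq5145_zG_mod_W6v_of_ineq5144_two_le_struct`
  (conclusion VERBATIM: `exp[−𝒫^L − Σ_X (W₆′(X) + W₆″(X))]`, `W₆′` as printed) with its multi-cube leaf hypothesis `h5144two` ((5.14.4), located, on
  the polymers with `≥ 2` cubes of every sub-region gas at every `t ∈ (0,1]`) REPLACED by **`h5144three`** (the same on the polymers with `≥ 3`
  cubes) plus the TWO-CUBE REGIME of `BIJ88Ineq5144TwoCube` (pair tail constant `A₂ = 4e^{F²/m}`, weight `e^{2GK₁}`: `Ĉ^{n̄+1}A₂e^{2GK₁}e_k ≤ 1`,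
  `e^{2GK₁}·2G·A₂·e_k + (e^{2GK₁} − 1) ≤ θ^{2β′}/2`, and the DECLARED ADJUSTMENT of print's per-derivative factor `e_k ≤ θ^{1+β′}/2`,
  `K_Y e^{2GK₁} ≤ θ^{1+β′}/2` — see that file's header: the join mechanism of p. 307 is NOT reproduced); proof = the structural head ∘ gen 17's
  `two_le_of_three_le`.
* §2 **`eq5145_three_le_fin2_coupled_uniform`** — KERNEL CERTIFICATE OF §1 WITH A THRESHOLD CHOSEN BEFORE THE DATUM, ON TWO ABUTTING CUBES
  WITH THE COUPLED PRECISION `!![2, 1; 1, 2]`: for `p > 1/2` and `n̄` there is `e₀ > 0` such that for every cube map of the form `Sum.inl b ↦ b`, every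
  cube-local `F`, every `e_k ∈ (0, e₀)`, `W`, `B_large`, `|L′| = n̄+1`, `γ`, the data «sites = cubes = `Fin 2`, abutting = `≠`, `Δ = !![2,1;1,2]`,
  `ℱ = 0`, one linear χ-slot per cube, `c ≡ 1`, no interaction terms, `χ = gevreyCutoff`, `𝒫^L = 0`, `W₆″_ρ(X′) = [X′ = ∅]·𝒫̃_ρ`» satisfy EVERY
  hypothesis of §1 (`h5144three` vacuously: no polymer of `Fin 2` has three cubes; `m = Λ = 1`, `F = 0`, `G = 1`, `K₁ = 0`, `D = 2`; `θ = e_k^{1/4}`,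
  `β′ = 1`), and the (5.14.5) identity holds for them — the first certificate of a (5.14.5) head whose multi-cube leaf input is discharged for
  COUPLED data (gen 16's certificates p338195/p339137/p340042 used block-diagonal `Δ`, where the multi-cube activities vanish).
HONEST SCOPE: exactly the head's scope with C1 narrowed to «(5.14.4) located on |X_β| ≥ 3»; `h311`, `hsmall`, the bounded terms `|V(Y)| ≤ K_Y`, the
finite-dimensional §5.13 model and the adjustment clause stay displayed; the inductive cluster-expansion decay (print: *"similar to the one for
g₂"*) is NOT proved and is vacuous on the two-cube certificate.  0 `sorry`, 0 definitions, 0 `Prop` facts (D-0026); imports `BIJ88Eq5145HeadStruct`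
(p36 g16) and `BIJ88Ineq5144TwoCubeLeaf` (p36 g17); modifies nothing.  NOT summit progress; NOT continuum; NOT Clay.  Cell `lit-balaban` Phase 2,
seat p36 gen 17 (owner r16 — the head pointer is the owner's call; referee ref-5).  v1.1 (gen 18): docstring-only — the p. 310 license quoted
verbatim with locator in the module docstring and in §1's docstring (referee condition (a) of the v2.228 countersign); declarations byte-identical to
v1.0 (p343893).
-/

noncomputable section

open Finset MeasureTheory Matrix ProbabilityTheory Filter
open Literature.MathematicalPhysics.QuantumFieldTheory.BalabanImbrieJaffe1984to88
open BIJ88PolymerRep5134 (g1 IsAdmissible corner)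
open BIJ88PolymerRep5134Gauss (ext expect zG src)
open BIJ88Resummation5141 (outer lam12)
open BIJ88Resummation5141Adm (lam12')
open BIJ88Expansion5143Gauss (fD)
open BIJ88SlotMomentsGauss308 (uD fieldLaw)
open BIJ88Sect2Statements (pLog)
open BIJ88Sect5Statements (CutoffProfile cutoff)
open BIJ88Sect5StatementsPart4 (pertP)
open BIJ88Eq5145CornerModel
open BIJ88Eq5145CornerUrsell (cubeIn)
open BIJ88W6PrimeVsupp (actIn W6v)
open BIJ88Ineq5144Located (locAct)
open BIJ88Eq5145HeadStruct (eq5145_zG_mod_W6v_of_ineq5144_two_le_struct)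
open BIJ88GaussIntegration309Product (exists_const_all_orders)
open BIJ88CutoffProfileWitness (gevreyCutoff chi1_nonneg)
open BIJ88SmallChargeRegime (exists_threshold eventually_const_le_mul_log_rpow eventually_const_mul_le_one eventually_le_one)
open BIJ88Ineq5144TwoCube (two_le_of_three_le)
open BIJ88Ineq5144TwoCubeLeaf (fin2Coupling_posDef_and_ge)

namespace Literature.MathematicalPhysics.QuantumFieldTheory.BalabanImbrieJaffe1984to88.BIJ88Eq5145HeadThreeCube

/-! ## §1 The structural head with the leaf hypothesis on the polymers with at least three cubes -/

section Head

variable {α I : Type} [Fintype α] [DecidableEq α] [Fintype I] [DecidableEq I]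
  (blk : α → I) (Δ : Matrix α α ℝ) (ℱ : α → ℝ)
variable (adj : I → I → Prop) [DecidableRel adj]
variable (χ : CutoffProfile) {ι υ : Type*} [DecidableEq ι] [DecidableEq υ]
variable {p ek : ℝ} {B : Finset ι} {Φ : ι → (α → ℝ) → ℝ} {c : ι → ℝ} {Ys : Finset υ} {V : υ → (α → ℝ) → ℝ}
variable (cube : ↥B ⊕ ↥Ys → I) {L : Type*} (γ : L → ↥B ⊕ ↥Ys)

/-- **(5.14.5) ON THE MODEL — THE STRUCTURAL HEAD WITH (5.14.4) ASSUMED ONLY ON THE POLYMERS WITH AT LEAST THREE CUBES** (p. 312 (5.14.5);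
p. 309 (5.14.4)): `BIJ88Eq5145HeadStruct.eq5145_zG_mod_W6v_of_ineq5144_two_le_struct` with `h5144two` replaced by `h5144three` and the two-cube
regime of `BIJ88Ineq5144TwoCube.ineq5144_locAct_pair_of_struct` (`hpre₂`, `hvac₂`, and the declared adjustment `hekθ₂`, `hKθ₂`: print's
per-derivative factor `θ = e^β(L^kε/ε₀)^{1/4−α}` replaced by `θ^{1+β′}/2` on the two-cube polymers — admitted under the license printed on p. 310,
verbatim: *"It is now a standard exercise to estimate the expansion, using (5.14.4). The result is |W₆^{(k)′}(X)| ≦ (e^β(L^kε/ε₀)^{1/4−α})^{n̄+1+β′|X|}.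
(We allow adjustments in β, α, β′, keeping them small.)"* [BalabanImbrieJaffe1988, p.310]; that the adjustment is FORCED at model level is the kernel
witness `BIJ88Ineq5144PairAdjustmentWitness.ineq5144_locAct_pair_unadjusted_false`, GAPS G-C2-p36-09); everything else and the conclusion verbatim.
[cite: BalabanImbrieJaffe1988, (5.14.5) p.312; (5.14.4) p.309; p.307 (Sect. 5.13); p.310 display 4 and the parenthesis following it; p.311] -/
theorem eq5145_zG_mod_W6v_of_ineq5144_three_le_struct [Fintype ι] [Fintype υ] {nbr : I → Finset I} {D : ℕ} {θ β' : ℝ}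
    (hR : ∀ x y, adj x y → adj y x) (hD : ∀ x, (nbr x).card ≤ D) (hnbr : ∀ x y, adj x y → y ∈ nbr x) (hθ0 : 0 < θ) (hθ1 : θ ≤ 1)
    (hβ : 0 ≤ β') (hsmall : 16 * ((D : ℝ) + 1) ^ 2 * (θ ^ (β' / 2) * Real.exp 2) ≤ 1)
    (hΔadj : ∀ x y, blk x ≠ blk y → ¬ adj (blk x) (blk y) → Δ x y = 0) (hΔ : Δ.PosDef)
    {m : ℝ} (hm : 0 < m) (hΔm : ∀ φ : α → ℝ, m * (φ ⬝ᵥ φ) ≤ φ ⬝ᵥ (Δ *ᵥ φ))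
    (hχ : ∀ x, 0 ≤ χ.χ₁ x) (hp : 1 / 2 < p) {Λ : ℝ} (hΛ : 0 < Λ)
    (hmod : ∀ b ∈ B, ∃ ℓ₁ ℓ₂ : (α → ℝ) → ℝ, IsLinearMap ℝ ℓ₁ ∧ IsLinearMap ℝ ℓ₂ ∧
      ((∀ φ, Φ b φ = ℓ₁ φ) ∨ (∀ φ, Φ b φ = Real.sqrt (ℓ₁ φ ^ 2 + ℓ₂ φ ^ 2))) ∧
      (∀ φ, |ℓ₁ φ| ≤ Λ * Real.sqrt (φ ⬝ᵥ φ)) ∧ (∀ φ, |ℓ₂ φ| ≤ Λ * Real.sqrt (φ ⬝ᵥ φ)))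
    {F : ℝ} (hF0 : 0 ≤ F) (hF : ∀ i : I, src blk ℱ {i} ⬝ᵥ src blk ℱ {i} ≤ F ^ 2)
    {c₀ : ℝ} (hc₀ : 0 < c₀) (hcb : ∀ b ∈ B, c₀ ≤ c b) (hV : ∀ Y ∈ Ys, Measurable (V Y)) {KY : υ → ℝ} (hK : ∀ Y ∈ Ys, ∀ φ, |V Y φ| ≤ KY Y)
    (hek : 0 < ek) (hek1 : ek < Real.exp (-1))
    (hΦloc : ∀ b : B, ∀ φ ψ : α → ℝ, (∀ x, blk x = cube (Sum.inl b) → φ x = ψ x) → Φ b φ = Φ b ψ)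
    (hVloc : ∀ Y : Ys, ∀ φ ψ : α → ℝ, (∀ x, blk x = cube (Sum.inr Y) → φ x = ψ x) → V Y φ = V Y ψ)
    (F' : I → (α → ℝ) → ℝ) (hFloc : ∀ i (φ ψ : α → ℝ), (∀ x, blk x = i → φ x = ψ x) → F' i φ = F' i ψ)
    {L' : Type} [Fintype L'] [DecidableEq L'] {nbar : ℕ} (hL : Fintype.card L' = nbar + 1)
    (W Bl : Finset I) (Vconst PL : ℝ) (W6pp : Finset (Finset I) → Finset I → ℝ)
    {C : ℝ} (hC1 : 1 ≤ C)
    (hC : ∀ i, i ≤ nbar + 1 → ∀ (A : ℝ) ⦃q e t : ℝ⦄, q ≠ 0 → 0 < e → 0 < t → t * e ≤ Real.exp (-1) →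
      |iteratedDeriv i (fun s => cutoff χ (q * pLog p (s * e)) A) t| ≤ C * t ^ (-(i : ℤ)))
    {K₁ : ℝ} (hK₁0 : 0 ≤ K₁) (hK₁ : ∀ Y ∈ Ys, KY Y ≤ K₁) {G : ℕ} (hG : ∀ i, (univ.filter fun τ : ↥B ⊕ ↥Ys => cube τ = i).card ≤ G)
    (hekθ : ek ≤ θ) (hreg : ((nbar + 1 : ℕ) : ℝ) + 1 ≤ m / (8 * Λ ^ 2) * (81 / 100) * c₀ ^ 2 * Real.log ek⁻¹ ^ (2 * p - 1))
    -- the one-cube regime (gens 15/16)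
    (hpre : C ^ (nbar + 1) * (4 * Real.exp (F ^ 2 / (2 * m))) * Real.exp (G * K₁) * ek ≤ 1) (hKθ : ∀ Y ∈ Ys, KY Y * Real.exp (G * K₁) ≤ θ)
    (hvac : Real.exp (G * K₁) * G * (4 * Real.exp (F ^ 2 / (2 * m))) * ek + (Real.exp (G * K₁) - 1) ≤ θ ^ β')
    -- the two-cube regime (gen 17), with the declared adjustment of the per-derivative factor
    (hpre₂ : C ^ (nbar + 1) * (4 * Real.exp (F ^ 2 / m)) * Real.exp (2 * G * K₁) * ek ≤ 1)
    (hvac₂ : Real.exp (2 * G * K₁) * (2 * G) * (4 * Real.exp (F ^ 2 / m)) * ek + (Real.exp (2 * G * K₁) - 1) ≤ θ ^ (2 * β') / 2)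
    (hekθ₂ : ek ≤ θ ^ (1 + β') / 2) (hKθ₂ : ∀ Y ∈ Ys, KY Y * Real.exp (2 * G * K₁) ≤ θ ^ (1 + β') / 2)
    -- (5.14.4) on the polymers with at least THREE cubes, located reading, for the data of every sub-region of `Λ₁₂` at every `t ∈ (0,1]`
    (h5144three : ∀ ρ ∈ (outer W Bl).filter (IsAdmissible adj), ∀ X' ⊆ lam12 W ρ, ∀ t ∈ Set.Ioc (0 : ℝ) 1,
      ∀ γ' : L' → ↥(slotB B Ys cube X') ⊕ ↥(slotY B Ys cube X'), ∀ (H : Finset L') (X'' : Finset I), 3 ≤ X''.card →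
        |locAct (cubeIn cube X' ∘ γ') (actIn blk Δ ℱ adj χ p ek B Φ c Ys V cube (lam12' adj W ρ) X' t γ') H X''| ≤
          θ ^ ((H.card : ℝ) + β' * ((X'' \ H.image (cubeIn cube X' ∘ γ')).card : ℝ)))
    (h311 : ∀ ρ ∈ (outer W Bl).filter (IsAdmissible adj),
      Vconst + pertP (fun t => Real.log (ztIn blk Δ ℱ χ p ek B Φ c Ys V cube (lam12 W ρ) (lam12' adj W ρ) t)) nbar =
        PL + ∑ X' : Finset I, W6pp ρ X') :
    Real.exp (-Vconst) * expect blk Δ ℱ (fun i φ => fD (uD χ p ek B Φ c Ys V 1) cube γ ∅ i φ * F' i φ) W (corner ℝ W) =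
      ∑ ρ ∈ (outer W Bl).filter (IsAdmissible adj),
        (∏ X ∈ ρ, g1 adj (zG blk Δ ℱ (fun i φ => fD (uD χ p ek B Φ c Ys V 1) cube γ ∅ i φ * F' i φ)) X) *
          (zG blk Δ ℱ (fun i φ => fD (uD χ p ek B Φ c Ys V 1) cube γ ∅ i φ * F' i φ) (lam12 W ρ) (lam12' adj W ρ) /
              zG blk Δ ℱ (fD (uD χ p ek B Φ c Ys V 1) cube γ ∅) (lam12 W ρ) (lam12' adj W ρ) *
            Real.exp (-PL - ∑ X' : Finset I,
              (W6v blk Δ ℱ adj χ p ek B Φ c Ys V cube (lam12' adj W ρ) (lam12 W ρ) L' nbar X' + W6pp ρ X'))) :=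
  eq5145_zG_mod_W6v_of_ineq5144_two_le_struct blk Δ ℱ adj χ cube γ hR hD hnbr hθ0 hθ1 hβ hsmall hΔadj hΔ hm hΔm hχ hp hΛ hmod hF0 hF hc₀
    hcb hV hK hek hek1 hΦloc hVloc F' hFloc hL W Bl Vconst PL W6pp hC1 hC hK₁0 hK₁ hG hekθ hreg hpre hKθ hvac
    (fun ρ hρ X' hX' t ht γ' H X'' h2 =>
      two_le_of_three_le blk Δ ℱ adj χ cube hp hC1 hC hΔ hm hΔm hχ hc₀ hcb hΛ hmod hF0 hF hV hK hK₁0 hK₁ hG hek hek1.le hθ0 hθ1 hβ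
        hreg hpre₂ hvac₂ hekθ₂ hKθ₂ (lam12' adj W ρ) X' ht hL.le γ' (h5144three ρ hρ X' hX' t ht γ') H X'' h2)
    h311

end Head

/-! ## §2 A kernel certificate on two abutting cubes with a coupled precision, uniform threshold -/
set_option maxHeartbeats 400000 in
/-- **KERNEL CERTIFICATE OF §1, COUPLED PRECISION, THRESHOLD BEFORE THE DATUM**: for `p > 1/2` and `n̄` there is `e₀ > 0` such that for every
cube map of the form `Sum.inl b ↦ b` on `Fin 2`, every cube-local `F`, every `e_k ∈ (0, e₀)`, `W`, `B_large`, `|L′| = n̄+1`, `γ`, the (5.14.5) identity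
of §1 holds for the data «sites = cubes = `Fin 2`, abutting = `≠` (degree `≤ 2`), precision `!![2, 1; 1, 2]` (COUPLED:
`BIJ88Ineq5144TwoCubeLeaf.fin2Coupling_apply_offDiag`), `ℱ = 0`, one linear χ-slot per cube (the site field), `c ≡ 1`, no interaction terms,
`χ = gevreyCutoff`, `𝒫^L = 0`, `W₆″_ρ(X′) = [X′ = ∅]·𝒫̃_ρ`» — every hypothesis of §1 discharged with `m = Λ = 1`, `F = 0`, `G = 1`, `K₁ = 0`,
`c₀ = 1`, `D = 2`, `θ = e_k^{1/4}`, `β′ = 1`, the all-orders constant `Ĉ(gevreyCutoff, p, n̄+1)`; `h5144three` holds vacuously (no polymer of `Fin 2`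
has three cubes). [cite: BalabanImbrieJaffe1988, (5.14.5) p.312; (5.14.4) p.309; p.307 (Sect. 5.13)] -/
theorem eq5145_three_le_fin2_coupled_uniform {p : ℝ} (hp : 1 / 2 < p) (nbar : ℕ) :
    ∃ e₀ : ℝ, 0 < e₀ ∧ ∀ {cube : ↥(univ : Finset (Fin 2)) ⊕ ↥(∅ : Finset (Fin 2)) → Fin 2} (_ : ∀ b, cube (Sum.inl b) = b.1)
        (F : Fin 2 → (Fin 2 → ℝ) → ℝ) (_ : ∀ i (φ ψ : Fin 2 → ℝ), (∀ x, x = i → φ x = ψ x) → F i φ = F i ψ) ⦃e : ℝ⦄, 0 < e → e < e₀ →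
      ∀ (W Bl : Finset (Fin 2)) {L' : Type} [Fintype L'] [DecidableEq L'] (_ : Fintype.card L' = nbar + 1)
        {L : Type} (γ : L → ↥(univ : Finset (Fin 2)) ⊕ ↥(∅ : Finset (Fin 2))),
        Real.exp (-0) * expect (id : Fin 2 → Fin 2) (!![2, 1; 1, 2] : Matrix (Fin 2) (Fin 2) ℝ) (0 : Fin 2 → ℝ)
            (fun i φ => fD (uD gevreyCutoff p e (univ : Finset (Fin 2)) (fun (i : Fin 2) (φ : Fin 2 → ℝ) => φ i) (fun _ => (1 : ℝ))
              (∅ : Finset (Fin 2)) (fun (_ : Fin 2) (_ : Fin 2 → ℝ) => (0 : ℝ)) 1) cube γ ∅ i φ * F i φ) W (corner ℝ W) =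
          ∑ ρ ∈ (outer W Bl).filter (IsAdmissible (fun x y : Fin 2 => x ≠ y)),
            (∏ X ∈ ρ, g1 (fun x y : Fin 2 => x ≠ y) (zG (id : Fin 2 → Fin 2) (!![2, 1; 1, 2] : Matrix (Fin 2) (Fin 2) ℝ) (0 : Fin 2 → ℝ)
              (fun i φ => fD (uD gevreyCutoff p e (univ : Finset (Fin 2)) (fun (i : Fin 2) (φ : Fin 2 → ℝ) => φ i) (fun _ => (1 : ℝ))
                (∅ : Finset (Fin 2)) (fun (_ : Fin 2) (_ : Fin 2 → ℝ) => (0 : ℝ)) 1) cube γ ∅ i φ * F i φ)) X) *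
              (zG (id : Fin 2 → Fin 2) (!![2, 1; 1, 2] : Matrix (Fin 2) (Fin 2) ℝ) (0 : Fin 2 → ℝ)
                  (fun i φ => fD (uD gevreyCutoff p e (univ : Finset (Fin 2)) (fun (i : Fin 2) (φ : Fin 2 → ℝ) => φ i) (fun _ => (1 : ℝ))
                    (∅ : Finset (Fin 2)) (fun (_ : Fin 2) (_ : Fin 2 → ℝ) => (0 : ℝ)) 1) cube γ ∅ i φ * F i φ) (lam12 W ρ)
                    (lam12' (fun x y : Fin 2 => x ≠ y) W ρ) /
                  zG (id : Fin 2 → Fin 2) (!![2, 1; 1, 2] : Matrix (Fin 2) (Fin 2) ℝ) (0 : Fin 2 → ℝ)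
                    (fD (uD gevreyCutoff p e (univ : Finset (Fin 2)) (fun (i : Fin 2) (φ : Fin 2 → ℝ) => φ i) (fun _ => (1 : ℝ))
                      (∅ : Finset (Fin 2)) (fun (_ : Fin 2) (_ : Fin 2 → ℝ) => (0 : ℝ)) 1) cube γ ∅) (lam12 W ρ)
                      (lam12' (fun x y : Fin 2 => x ≠ y) W ρ) *
                Real.exp (-0 - ∑ X' : Finset (Fin 2),
                  (W6v (id : Fin 2 → Fin 2) (!![2, 1; 1, 2] : Matrix (Fin 2) (Fin 2) ℝ) (0 : Fin 2 → ℝ) (fun x y : Fin 2 => x ≠ y)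
                      gevreyCutoff p e (univ : Finset (Fin 2)) (fun (i : Fin 2) (φ : Fin 2 → ℝ) => φ i) (fun _ => (1 : ℝ)) (∅ : Finset (Fin 2))
                      (fun (_ : Fin 2) (_ : Fin 2 → ℝ) => (0 : ℝ)) cube (lam12' (fun x y : Fin 2 => x ≠ y) W ρ) (lam12 W ρ) L' nbar X' +
                    (if X' = ∅ then pertP (fun t => Real.log (ztIn (id : Fin 2 → Fin 2) (!![2, 1; 1, 2] : Matrix (Fin 2) (Fin 2) ℝ)
                      (0 : Fin 2 → ℝ) gevreyCutoff p e (univ : Finset (Fin 2)) (fun (i : Fin 2) (φ : Fin 2 → ℝ) => φ i) (fun _ => (1 : ℝ))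
                      (∅ : Finset (Fin 2)) (fun (_ : Fin 2) (_ : Fin 2 → ℝ) => (0 : ℝ)) cube (lam12 W ρ)
                      (lam12' (fun x y : Fin 2 => x ≠ y) W ρ) t)) nbar else 0)))) := by
  classical
  -- the all-orders constant of the profile for the orders `≤ n̄+1` and gen 5's constant `M = 16(D+1)²e²` at `D = 2`: both BEFORE the threshold
  obtain ⟨C, hC1, hC⟩ := exists_const_all_orders gevreyCutoff p (nbar + 1)
  set M : ℝ := 16 * ((2 : ℝ) + 1) ^ 2 * Real.exp 2 with hM
  have hM0 : 0 < M := by positivity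
  have hκ0 : 0 < 1 / (8 * (1 : ℝ) ^ 2) * (81 / 100) * (1 : ℝ) ^ 2 := by positivity
  obtain ⟨δ, hδ, hreg⟩ := exists_threshold (Q := fun x : ℝ =>
      (((nbar + 1 : ℕ) : ℝ) + 1 ≤ 1 / (8 * (1 : ℝ) ^ 2) * (81 / 100) * (1 : ℝ) ^ 2 * Real.log x⁻¹ ^ (2 * p - 1)) ∧ 2 * Real.exp 1 * x ≤ 1 ∧
        C ^ (nbar + 1) * 4 * x ≤ 1 ∧ 256 * x ≤ 1 ∧ M ^ 8 * x ≤ 1 ∧ x ≤ 1) (by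
    filter_upwards [eventually_const_le_mul_log_rpow (((nbar + 1 : ℕ) : ℝ) + 1) _ (2 * p - 1) hκ0 (by linarith),
      eventually_const_mul_le_one (2 * Real.exp 1), eventually_const_mul_le_one (C ^ (nbar + 1) * 4), eventually_const_mul_le_one 256,
      eventually_const_mul_le_one (M ^ 8), eventually_le_one] with x h1 h2 h3 h4 h5 h6
    exact ⟨h1, h2, h3, h4, h5, h6⟩)
  refine ⟨δ, hδ, ?_⟩
  intro cube hcube F hFloc e he heδ W Bl L' _ _ hL L γ
  obtain ⟨h1, h2, h3, h4, h5, h6⟩ := hreg e he heδ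
  -- elementary consequences of the regime (`θ = e^{1/4} = √√e`)
  have hek1 : e < Real.exp (-1) := by
    rw [Real.exp_neg, ← one_div, lt_div_iff₀ (Real.exp_pos 1)]
    nlinarith [Real.exp_pos 1]
  set s : ℝ := Real.sqrt e with hs
  set θ : ℝ := Real.sqrt s with hθ
  have hs0 : 0 < s := Real.sqrt_pos.2 he
  have hθ0 : 0 < θ := Real.sqrt_pos.2 hs0
  have hss : s * s = e := Real.mul_self_sqrt he.le
  have hθθ : θ * θ = s := Real.mul_self_sqrt hs0.le
  have hs16 : s ≤ 1 / 16 := by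
    have h16 : e ≤ (1 / 16) ^ 2 := by nlinarith
    calc s ≤ Real.sqrt ((1 / 16) ^ 2) := Real.sqrt_le_sqrt h16
      _ = 1 / 16 := Real.sqrt_sq (by norm_num)
  have hs1 : s ≤ 1 := by linarith
  have hθ1 : θ ≤ 1 := by rw [hθ, ← Real.sqrt_one]; exact Real.sqrt_le_sqrt hs1
  have hes : e ≤ s := by nlinarith
  have hsθ : s ≤ θ := by nlinarith
  have hθsq : θ ^ ((1 : ℝ) + 1) = s := by rw [show (1 : ℝ) + 1 = (2 : ℕ) by norm_num, Real.rpow_natCast, pow_two, hθθ]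
  have hθsq' : θ ^ ((2 : ℝ) * 1) = s := by rw [mul_one, show (2 : ℝ) = (2 : ℕ) by norm_num, Real.rpow_natCast, pow_two, hθθ]
  have hsmall : 16 * (((2 : ℕ) : ℝ) + 1) ^ 2 * (θ ^ ((1 : ℝ) / 2) * Real.exp 2) ≤ 1 := by
    have hx : e ≤ (((1 / M) ^ 2) ^ 2) ^ 2 := by
      rw [← pow_mul, ← pow_mul, show 2 * 2 * 2 = 8 by norm_num, div_pow, one_pow, le_div_iff₀ (pow_pos hM0 8)]; linarith
    have hs1' : s ≤ ((1 / M) ^ 2) ^ 2 := (Real.sqrt_le_left (by positivity)).2 hx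
    have hs2 : θ ≤ (1 / M) ^ 2 := (Real.sqrt_le_left (by positivity)).2 hs1'
    have hs3 : Real.sqrt θ ≤ 1 / M := (Real.sqrt_le_left (by positivity)).2 hs2
    rw [← Real.sqrt_eq_rpow]
    calc 16 * (((2 : ℕ) : ℝ) + 1) ^ 2 * (Real.sqrt θ * Real.exp 2) = M * Real.sqrt θ := by rw [hM]; push_cast; ring
      _ ≤ M * (1 / M) := by gcongr
      _ = 1 := by field_simp
  -- the structural data: `Δ = !![2,1;1,2] ≥ 1·1`, slot fields = coordinates (`Λ = 1`), `ℱ = 0` (`F = 0`), one slot per cube, `adj = ≠`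
  obtain ⟨hΔ, hΔm⟩ := fin2Coupling_posDef_and_ge
  have hlin : ∀ i : Fin 2, IsLinearMap ℝ (fun φ : Fin 2 → ℝ => φ i) := fun i => (LinearMap.proj (R := ℝ) (φ := fun _ : Fin 2 => ℝ) i).isLinear
  have hΛ : ∀ (i : Fin 2) (φ : Fin 2 → ℝ), |φ i| ≤ 1 * Real.sqrt (φ ⬝ᵥ φ) := fun i φ => by
    rw [one_mul]
    refine Real.abs_le_sqrt ?_
    rw [pow_two]
    exact Finset.single_le_sum (f := fun j => φ j * φ j) (fun j _ => mul_self_nonneg (φ j)) (mem_univ i)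
  have hF : ∀ i : Fin 2, src (id : Fin 2 → Fin 2) (0 : Fin 2 → ℝ) {i} ⬝ᵥ src (id : Fin 2 → Fin 2) (0 : Fin 2 → ℝ) {i} ≤ (0 : ℝ) ^ 2 :=
    fun i => by simp [BIJ88PolymerRep5134Gauss.src, dotProduct]
  have hG : ∀ i : Fin 2, (univ.filter fun τ : ↥(univ : Finset (Fin 2)) ⊕ ↥(∅ : Finset (Fin 2)) => cube τ = i).card ≤ 1 := fun i =>
    card_le_one.2 fun a ha b hb => by
      obtain ⟨-, ha⟩ := mem_filter.1 ha
      obtain ⟨-, hb⟩ := mem_filter.1 hb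
      rcases a with a | a
      · rcases b with b | b
        · rw [hcube] at ha hb
          rw [Subtype.ext (ha.trans hb.symm)]
        · exact absurd b.2 (notMem_empty _)
      · exact absurd a.2 (notMem_empty _)
  -- the regime inequalities of §1 (`G = 1`, `K₁ = 0`, `m = Λ = 1`, `F = 0`, `θ = e^{1/4}`, `β′ = 1`)
  have hA1 : (4 * Real.exp ((0 : ℝ) ^ 2 / (2 * 1))) = 4 := by simp
  have hA2 : (4 * Real.exp ((0 : ℝ) ^ 2 / 1)) = 4 := by simp
  have hW1 : Real.exp (((1 : ℕ) : ℝ) * 0) = 1 := by simp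
  have hW2 : Real.exp (2 * ((1 : ℕ) : ℝ) * 0) = 1 := by simp
  have hpre : C ^ (nbar + 1) * (4 * Real.exp ((0 : ℝ) ^ 2 / (2 * 1))) * Real.exp (((1 : ℕ) : ℝ) * 0) * e ≤ 1 := by
    rw [hA1, hW1, mul_one]; exact h3
  have hpre₂ : C ^ (nbar + 1) * (4 * Real.exp ((0 : ℝ) ^ 2 / 1)) * Real.exp (2 * ((1 : ℕ) : ℝ) * 0) * e ≤ 1 := by
    rw [hA2, hW2, mul_one]; exact h3
  have hvac : Real.exp (((1 : ℕ) : ℝ) * 0) * ((1 : ℕ) : ℝ) * (4 * Real.exp ((0 : ℝ) ^ 2 / (2 * 1))) * e + (Real.exp (((1 : ℕ) : ℝ) * 0) - 1) ≤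
      θ ^ (1 : ℝ) := by
    rw [hA1, hW1, Real.rpow_one]
    norm_num
    nlinarith
  have hvac₂ : Real.exp (2 * ((1 : ℕ) : ℝ) * 0) * (2 * ((1 : ℕ) : ℝ)) * (4 * Real.exp ((0 : ℝ) ^ 2 / 1)) * e +
      (Real.exp (2 * ((1 : ℕ) : ℝ) * 0) - 1) ≤ θ ^ ((2 : ℝ) * 1) / 2 := by
    rw [hA2, hW2, hθsq']
    norm_num
    nlinarith
  have hekθ₂ : e ≤ θ ^ ((1 : ℝ) + 1) / 2 := by rw [hθsq]; nlinarith
  have hreg' : ((nbar + 1 : ℕ) : ℝ) + 1 ≤ 1 / (8 * (1 : ℝ) ^ 2) * (81 / 100) * (1 : ℝ) ^ 2 * Real.log e⁻¹ ^ (2 * p - 1) := h1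
  have hnbr : ∀ x y : Fin 2, x ≠ y → y ∈ (univ : Finset (Fin 2)) := fun _ y _ => mem_univ y
  have hD : ∀ x : Fin 2, (univ : Finset (Fin 2)).card ≤ 2 := fun _ => by simp
  exact eq5145_zG_mod_W6v_of_ineq5144_three_le_struct (id : Fin 2 → Fin 2) _ (0 : Fin 2 → ℝ) (fun x y : Fin 2 => x ≠ y) gevreyCutoff cube γ
    (nbr := fun _ => univ) (D := 2) (θ := θ) (β' := 1) (fun x y h => Ne.symm h) hD hnbr hθ0 hθ1 zero_le_one hsmall
    (fun x y hxy hn => absurd hxy hn) hΔ (m := 1) one_pos hΔm chi1_nonneg hp (Λ := 1) one_pos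
    (fun b _ => ⟨fun φ => φ b, fun φ => φ b, hlin b, hlin b, Or.inl fun _ => rfl, hΛ b, hΛ b⟩) (F := 0) le_rfl hF (c₀ := 1) one_pos
    (fun _ _ => le_rfl) (fun Y hY => absurd hY (notMem_empty Y)) (KY := fun _ => 0) (fun Y hY => absurd hY (notMem_empty Y)) he hek1
    (fun b φ ψ h => h b.1 (by rw [hcube]; rfl)) (fun Y => absurd Y.2 (notMem_empty _)) F (fun i φ ψ h => hFloc i φ ψ fun x hx => h x hx)
    hL W Bl 0 0
    (fun ρ X' => if X' = ∅ then pertP (fun t => Real.log (ztIn (id : Fin 2 → Fin 2) (!![2, 1; 1, 2] : Matrix (Fin 2) (Fin 2) ℝ)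
      (0 : Fin 2 → ℝ) gevreyCutoff p e (univ : Finset (Fin 2)) (fun (i : Fin 2) (φ : Fin 2 → ℝ) => φ i) (fun _ => (1 : ℝ))
      (∅ : Finset (Fin 2)) (fun (_ : Fin 2) (_ : Fin 2 → ℝ) => (0 : ℝ)) cube (lam12 W ρ) (lam12' (fun x y : Fin 2 => x ≠ y) W ρ) t)) nbar
      else 0)
    hC1 hC (K₁ := 0) le_rfl (fun Y hY => absurd hY (notMem_empty Y)) (G := 1) hG (hes.trans hsθ) hreg' hpre
    (fun Y hY => absurd hY (notMem_empty Y)) hvac hpre₂ hvac₂ hekθ₂ (fun Y hY => absurd hY (notMem_empty Y))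
    (fun ρ _ X' _ t _ γ' H X'' hX'' => absurd ((card_le_univ X'').trans (Fintype.card_fin 2).le) (by omega))
    (fun ρ _ => by simp)

end Literature.MathematicalPhysics.QuantumFieldTheory.BalabanImbrieJaffe1984to88.BIJ88Eq5145HeadThreeCube

end
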